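import Literature.MathematicalPhysics.QuantumLattice.HubbardTTPrimeAffineBoxWords
import Literature.MathematicalPhysics.QuantumLattice.HubbardTTPrimeFreeSandwichBoxWords
import Literature.MathematicalPhysics.QuantumLattice.HubbardTTPrimeBoxTransport
import HarnessLib

/-!
# AFFINE box words for the `t–t'` Hubbard energy density — ADAPTERS from the producers' row and plane
# shapes to the corner-row / rectangle-plane hypotheses of `HubbardTTPrimeAffineBoxWords`

Family `hubbard` (topic `MathematicalPhysics/QuantumLattice`), companion of
`HubbardTTPrimeAffineBoxWords` (§2 `energyDensityTT'_affineFloor_Icc₃_of_cornerRows` wants, at each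
`(U, t')`-corner of a cell, a CORNER ROW `∀ m ∈ Set.Icc n₁ n₂, a + b·m ≤ e(t, s_j, U_i, m)`; §3
`energyDensityTT'_affineCap_Icc₃_of_endPlanes` wants, at each slab-end density, a RECTANGLE PLANE
`∀ u s, U₁ ≤ u → u ≤ U₂ → s₁ ≤ s → s ≤ s₂ → e(t, s, u, n_c) ≤ P + Q·u + R·s`). The producers in the
tree state their floors and caps in a handful of fixed shapes; this file turns each into the wanted
hypothesis by a one-line restriction, so that an affine-word file is `theorem … := affineFloor… (cornerRow_of_… row₁) …`
with no algebra of its own: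

* corner rows from kernel Fermi-sea tangent rows `∀ U ≥ 0, ∀ 0 ≤ n < 2, a + b n ≤ e(t, s₀, U, n)`
  (`cornerRow_of_forall_density`), from a node's density row `∀ 0 ≤ m < 2, a + b m ≤ e(t, s₀, U₀, m)`
  (`cornerRow_of_forall_density_at`, and the `a + b (m − n₀)` spelling `…_at_sub`), from a point floor
  on a face (`cornerRow_of_point`), restriction to a sub-slab (`cornerRow_mono`);
* rectangle planes from a `U`-uniform affine-in-`t'` cap `A + s·B` (polarised sea,
  `rectPlane_of_uniformU`), from a Hartree–Fock cap `2(A + s·B) + U·(n/2)²` (`rectPlane_of_hartreeFock`),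
  from a VARBOX plane `A + max (s·Blo) (s·Bhi) + U·D` on a sign-definite `t'`-strip
  (`rectPlane_of_varbox_nonpos / _nonneg`), from constants (`rectPlane_of_const`, `_of_const_below`,
  `_of_capAtUpperU` — a point cap at the upper `U`-edge read below by monotonicity), restriction
  (`rectPlane_mono`); and straight from a KERNEL CERTIFICATE `polarizedPlaneCheck … = true`
  (`HubbardTTPrimePolarizedSeaCapTable`): the polarised-sea plane `A + B·s`
  (`rectPlane_of_polarizedPlaneCheck`) and its Hartree–Fock half-density reading
  `2A + (n/2)²·u + 2B·s` (`rectPlane_of_hartreeFockPlaneCheck`).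

* §4 MERGING PIECES INTO ONE AFFINE WORD: an affine function `≥ 0` at the eight vertices of a box is
  `≥ 0` on it (`affine₃_nonneg_on_Icc₃`), hence an affine floor / cap may be WEAKENED to any affine
  function below / above it at the vertices (`affineFloor_Icc₃_weaken`, `affineCap_Icc₃_weaken` — how
  one common `(L, H)` is put under / over the per-cell ones before gluing); and the `t'`-SLIVER cells
  beyond the last free-row column (`affineFloor_Icc₃_tPrime_sliver_right/left`,
  `affineCap_Icc₃_tPrime_sliver_right/left`: the face value carried at the kinematic Lipschitz price
  `1.6212·|Δt'|` of `energyDensityTT'_tPrime_transport_ge_decimal`, itself affine in `t'`).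

Everything is a restriction or `linarith`; no definition, no number, no physics beyond
`energyDensityTT'_mono_U` and the `t'`-Lipschitz bound. WHAT THIS IS NOT: a bound at any anchor; a
phase word.

## References

* V. Bach, E. H. Lieb, J. P. Solovej, *Generalized Hartree–Fock theory and the Hubbard model*,
  J. Stat. Phys. 76 (1994), eq. (2c.36) (trial-state energies affine in the couplings; monotonicity in
  `U`). [cite: BachLiebSolovej1994, eq. (2c.36)]
* E. H. Lieb, M. Loss, *Fluxes, Laplacians, and Kasteleyn's theorem*, Duke Math. J. 71 (1993), §8
  Thm 8.2 (free Fermi-sea rows). [cite: LiebLoss1993, §8, Theorem 8.2]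
* D. Ruelle, *Statistical Mechanics: Rigorous Results*, 1969, §3.3. [cite: Ruelle1969, §3.3]
* A. Neumaier, Acta Numerica 13 (2004), §12 (sub-box bookkeeping). [cite: Neumaier2004CompleteSearch, §12]
-/

noncomputable section

namespace Literature.MathematicalPhysics.QuantumLattice

namespace ThermodynamicLimit

open Set
open Literature.MathematicalPhysics.QuantumLattice.TTPrimeFree

/-! ### §1 Corner rows (floors) -/

/-- A kernel tangent row `∀ U ≥ 0, ∀ 0 ≤ n < 2, a + b n ≤ e(t, s₀, U, n)` (the shape of the
`fermiSeaTangentRow_*` theorems) is a corner row on any slab `[n₁, n₂] ⊆ [0, 2)` at any `U₀ ≥ 0`.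
[cite: LiebLoss1993, §8, Theorem 8.2] -/
theorem cornerRow_of_forall_density {t s₀ a b : ℝ}
    (h : ∀ {U : ℝ}, 0 ≤ U → ∀ {n : ℝ}, 0 ≤ n → n < 2 → a + b * n ≤ energyDensityTT' t s₀ U n)
    {U₀ n₁ n₂ : ℝ} (hU₀ : 0 ≤ U₀) (hn0 : 0 ≤ n₁) (hn2 : n₂ < 2) :
    ∀ m ∈ Set.Icc n₁ n₂, a + b * m ≤ energyDensityTT' t s₀ U₀ m :=
  fun _ hm => h hU₀ (hn0.trans hm.1) (lt_of_le_of_lt hm.2 hn2)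

/-- A node's density row `∀ 0 ≤ m < 2, a + b m ≤ e(t, s₀, U₀, m)` (an `n`-tangent / `n`-sheet at a
certified node) is a corner row on any slab `[n₁, n₂] ⊆ [0, 2)`. [cite: Ruelle1969, §3.3] -/
theorem cornerRow_of_forall_density_at {t s₀ U₀ a b : ℝ}
    (h : ∀ m : ℝ, 0 ≤ m → m < 2 → a + b * m ≤ energyDensityTT' t s₀ U₀ m)
    {n₁ n₂ : ℝ} (hn0 : 0 ≤ n₁) (hn2 : n₂ < 2) :
    ∀ m ∈ Set.Icc n₁ n₂, a + b * m ≤ energyDensityTT' t s₀ U₀ m :=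
  fun m hm => h m (hn0.trans hm.1) (lt_of_le_of_lt hm.2 hn2)

/-- A node's density row written around its touching density, `a + b (m − n₀) ≤ e(t, s₀, U₀, m)` for
`0 ≤ m < 2`, as a corner row `(a − b n₀) + b m ≤ e` on a slab. [cite: Ruelle1969, §3.3] -/
theorem cornerRow_of_forall_density_at_sub {t s₀ U₀ a b n₀ : ℝ}
    (h : ∀ m : ℝ, 0 ≤ m → m < 2 → a + b * (m - n₀) ≤ energyDensityTT' t s₀ U₀ m)
    {n₁ n₂ : ℝ} (hn0 : 0 ≤ n₁) (hn2 : n₂ < 2) :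
    ∀ m ∈ Set.Icc n₁ n₂, (a - b * n₀) + b * m ≤ energyDensityTT' t s₀ U₀ m := by
  intro m hm
  have := h m (hn0.trans hm.1) (lt_of_le_of_lt hm.2 hn2)
  linarith

/-- A point floor `f ≤ e(t, s₀, U₀, n₀)` is a corner row on the degenerate slab `[n₀, n₀]` (face words).
[cite: Rockafellar1970, Thm 32.2] -/
theorem cornerRow_of_point {t s₀ U₀ n₀ f : ℝ} (h : f ≤ energyDensityTT' t s₀ U₀ n₀) :
    ∀ m ∈ Set.Icc n₀ n₀, f + 0 * m ≤ energyDensityTT' t s₀ U₀ m := by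
  intro m hm
  have hm' : m = n₀ := le_antisymm hm.2 hm.1
  rw [hm', zero_mul, add_zero]; exact h

/-- A corner row on a slab restricts to a sub-slab. [cite: Neumaier2004CompleteSearch, §12] -/
theorem cornerRow_mono {t s₀ U₀ a b n₁ n₂ n₁' n₂' : ℝ}
    (h : ∀ m ∈ Set.Icc n₁ n₂, a + b * m ≤ energyDensityTT' t s₀ U₀ m) (h₁ : n₁ ≤ n₁') (h₂ : n₂' ≤ n₂) :
    ∀ m ∈ Set.Icc n₁' n₂', a + b * m ≤ energyDensityTT' t s₀ U₀ m :=
  fun m hm => h m ⟨h₁.trans hm.1, hm.2.trans h₂⟩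

/-! ### §2 Rectangle planes (caps) -/

/-- A `U`-UNIFORM affine-in-`t'` cap `∀ U ≥ 0, ∀ s ∈ [s₁, s₂], e(t, s, U, n₀) ≤ A + s·B` (the shape of
the polarised-sea plane `energyDensityTT'_le_affine_of_polarizedPlaneCheck`) is a rectangle plane with
`U`-coefficient `0` on any `[U₁, U₂]` with `U₁ ≥ 0`. [cite: BachLiebSolovej1994, eq. (2c.36)] -/
theorem rectPlane_of_uniformU {t n₀ A B s₁ s₂ : ℝ}
    (h : ∀ {U : ℝ}, 0 ≤ U → ∀ {s : ℝ}, s₁ ≤ s → s ≤ s₂ → energyDensityTT' t s U n₀ ≤ A + s * B)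
    {U₁ U₂ : ℝ} (hU₁ : 0 ≤ U₁) :
    ∀ u s : ℝ, U₁ ≤ u → u ≤ U₂ → s₁ ≤ s → s ≤ s₂ →
      energyDensityTT' t s u n₀ ≤ A + 0 * u + B * s := by
  intro u s hu₁ _ hs₁ hs₂
  have := h (hU₁.trans hu₁) hs₁ hs₂
  linarith

/-- A Hartree–Fock cap `∀ U ≥ 0, ∀ s ∈ [s₁, s₂], e(t, s, U, n₀) ≤ 2(A + s·B) + U (n₀/2)²` (the shape
of `energyDensityTT'_le_hartreeFock_of_polarizedPlaneCheck`) is the rectangle plane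
`2A + (n₀/2)²·u + 2B·s` on any `[U₁, U₂]` with `U₁ ≥ 0`. [cite: BachLiebSolovej1994, eq. (2c.36)] -/
theorem rectPlane_of_hartreeFock {t n₀ A B s₁ s₂ : ℝ}
    (h : ∀ {U : ℝ}, 0 ≤ U → ∀ {s : ℝ}, s₁ ≤ s → s ≤ s₂ →
      energyDensityTT' t s U n₀ ≤ 2 * (A + s * B) + U * (n₀ / 2) ^ 2)
    {U₁ U₂ : ℝ} (hU₁ : 0 ≤ U₁) :
    ∀ u s : ℝ, U₁ ≤ u → u ≤ U₂ → s₁ ≤ s → s ≤ s₂ →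
      energyDensityTT' t s u n₀ ≤ 2 * A + (n₀ / 2) ^ 2 * u + (2 * B) * s := by
  intro u s hu₁ _ hs₁ hs₂
  have := h (hU₁.trans hu₁) hs₁ hs₂
  linarith

/-- A VARBOX plane `∀ t', ∀ U ≥ 0, e(t, t', U, n₀) ≤ A + max (t'·Blo) (t'·Bhi) + U·D` (a fixed trial
state's energy, affine in `(t', U)`, with an enclosure `Blo ≤ Bhi` of the `t'`-coefficient) on a strip
`t' ≤ s₂ ≤ 0` is the rectangle plane `A + D·u + Blo·s` (`U₁ ≥ 0`). [cite: BachLiebSolovej1994, eq. (2c.36)] -/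
theorem rectPlane_of_varbox_nonpos {t n₀ A Blo Bhi D : ℝ}
    (h : ∀ (t' U : ℝ), 0 ≤ U → energyDensityTT' t t' U n₀ ≤ A + max (t' * Blo) (t' * Bhi) + U * D)
    (hB : Blo ≤ Bhi) {U₁ U₂ s₁ s₂ : ℝ} (hU₁ : 0 ≤ U₁) (hs₂ : s₂ ≤ 0) :
    ∀ u s : ℝ, U₁ ≤ u → u ≤ U₂ → s₁ ≤ s → s ≤ s₂ →
      energyDensityTT' t s u n₀ ≤ A + D * u + Blo * s := by
  intro u s hu₁ _ _ hs
  have h1 := h s u (hU₁.trans hu₁)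
  have hs0 : s ≤ 0 := hs.trans hs₂
  have hmax : max (s * Blo) (s * Bhi) ≤ Blo * s := by
    refine max_le (by linarith) ?_
    have := mul_le_mul_of_nonpos_left hB hs0
    linarith
  linarith

/-- The same VARBOX plane on a strip `0 ≤ s₁ ≤ t'` is the rectangle plane `A + D·u + Bhi·s`.
[cite: BachLiebSolovej1994, eq. (2c.36)] -/
theorem rectPlane_of_varbox_nonneg {t n₀ A Blo Bhi D : ℝ}
    (h : ∀ (t' U : ℝ), 0 ≤ U → energyDensityTT' t t' U n₀ ≤ A + max (t' * Blo) (t' * Bhi) + U * D)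
    (hB : Blo ≤ Bhi) {U₁ U₂ s₁ s₂ : ℝ} (hU₁ : 0 ≤ U₁) (hs₁ : 0 ≤ s₁) :
    ∀ u s : ℝ, U₁ ≤ u → u ≤ U₂ → s₁ ≤ s → s ≤ s₂ →
      energyDensityTT' t s u n₀ ≤ A + D * u + Bhi * s := by
  intro u s hu₁ _ hs _
  have h1 := h s u (hU₁.trans hu₁)
  have hs0 : 0 ≤ s := hs₁.trans hs
  have hmax : max (s * Blo) (s * Bhi) ≤ Bhi * s := by
    refine max_le ?_ (by linarith)
    have := mul_le_mul_of_nonneg_left hB hs0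
    linarith
  linarith

/-- A constant cap on the rectangle is a rectangle plane with zero slopes.
[cite: Neumaier2004CompleteSearch, §12] -/
theorem rectPlane_of_const {t n₀ C U₁ U₂ s₁ s₂ : ℝ}
    (h : ∀ u s : ℝ, U₁ ≤ u → u ≤ U₂ → s₁ ≤ s → s ≤ s₂ → energyDensityTT' t s u n₀ ≤ C) :
    ∀ u s : ℝ, U₁ ≤ u → u ≤ U₂ → s₁ ≤ s → s ≤ s₂ →
      energyDensityTT' t s u n₀ ≤ C + 0 * u + 0 * s := by
  intro u s hu₁ hu₂ hs₁ hs₂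
  simpa using h u s hu₁ hu₂ hs₁ hs₂

/-- A cap `e(t, s, U, n₀) ≤ C` valid for `0 ≤ U ≤ U₂` and `s ∈ [s₁, s₂]` (e.g. a point cap at `U₂`
read below by monotonicity in `U`) as a rectangle plane on `[U₁, U₂]`, `U₁ ≥ 0`.
[cite: Neumaier2004CompleteSearch, §12] -/
theorem rectPlane_of_const_below {t n₀ C U₂ s₁ s₂ : ℝ}
    (h : ∀ {U : ℝ}, 0 ≤ U → U ≤ U₂ → ∀ {s : ℝ}, s₁ ≤ s → s ≤ s₂ → energyDensityTT' t s U n₀ ≤ C)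
    {U₁ : ℝ} (hU₁ : 0 ≤ U₁) :
    ∀ u s : ℝ, U₁ ≤ u → u ≤ U₂ → s₁ ≤ s → s ≤ s₂ →
      energyDensityTT' t s u n₀ ≤ C + 0 * u + 0 * s := by
  intro u s hu₁ hu₂ hs₁ hs₂
  simpa using h (hU₁.trans hu₁) hu₂ hs₁ hs₂

/-- A rectangle plane restricts to a sub-rectangle. [cite: Neumaier2004CompleteSearch, §12] -/
theorem rectPlane_mono {t n₀ P Q R U₁ U₂ s₁ s₂ U₁' U₂' s₁' s₂' : ℝ}
    (h : ∀ u s : ℝ, U₁ ≤ u → u ≤ U₂ → s₁ ≤ s → s ≤ s₂ → energyDensityTT' t s u n₀ ≤ P + Q * u + R * s)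
    (hU₁ : U₁ ≤ U₁') (hU₂ : U₂' ≤ U₂) (hs₁ : s₁ ≤ s₁') (hs₂ : s₂' ≤ s₂) :
    ∀ u s : ℝ, U₁' ≤ u → u ≤ U₂' → s₁' ≤ s → s ≤ s₂' →
      energyDensityTT' t s u n₀ ≤ P + Q * u + R * s :=
  fun u s hu₁ hu₂ hs₁' hs₂' => h u s (hU₁.trans hu₁) (hu₂.trans hU₂) (hs₁.trans hs₁') (hs₂'.trans hs₂)

/-- A point cap `e(t, s, U₂, n₀) ≤ C` for `s ∈ [s₁, s₂]` at the cell's upper `U`-edge caps the whole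
rectangle `0 ≤ U ≤ U₂` (`e` is nondecreasing in `U`; `0 ≤ n₀ < 2`). [cite: BachLiebSolovej1994, eq. (2c.36)] -/
theorem rectPlane_of_capAtUpperU {t n₀ C U₂ s₁ s₂ : ℝ} (hn0 : 0 ≤ n₀) (hn2 : n₀ < 2)
    (h : ∀ {s : ℝ}, s₁ ≤ s → s ≤ s₂ → energyDensityTT' t s U₂ n₀ ≤ C) {U₁ : ℝ} (hU₁ : 0 ≤ U₁) :
    ∀ u s : ℝ, U₁ ≤ u → u ≤ U₂ → s₁ ≤ s → s ≤ s₂ →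
      energyDensityTT' t s u n₀ ≤ C + 0 * u + 0 * s := by
  intro u s hu₁ hu₂ hs₁ hs₂
  have hm := energyDensityTT'_mono_U t s hn0 hn2 (hU₁.trans hu₁) hu₂
  have := h hs₁ hs₂
  simp only [zero_mul, add_zero]
  exact hm.trans this

/-! ### §3 Rectangle planes straight from a kernel `polarizedPlaneCheck` certificate -/

/-- **Polarised-sea certificate ⇒ rectangle plane.** A kernel-checked certificate
`polarizedPlaneCheck M t s₁ s₂ sel card A B = true` at density `n = card/M²` gives, on any rectangle
`[U₁, U₂] × [s₁, s₂]` with `U₁ ≥ 0`, the plane `e(t, s, u, n) ≤ A + 0·u + B·s`.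
[cite: BachLiebSolovej1994, eq. (2c.36)] -/
theorem rectPlane_of_polarizedPlaneCheck {M : ℕ} (hM : 0 < M) {t s₁ s₂ : ℚ}
    {sel : ℕ → ℕ → Bool} {card : ℕ} {A B : ℚ}
    (h : polarizedPlaneCheck M t s₁ s₂ sel card A B = true) {n : ℝ} (hn : n * (M : ℝ) ^ 2 = card)
    {U₁ U₂ : ℝ} (hU₁ : 0 ≤ U₁) :
    ∀ u s : ℝ, U₁ ≤ u → u ≤ U₂ → (s₁ : ℝ) ≤ s → s ≤ (s₂ : ℝ) →
      energyDensityTT' (t : ℝ) s u n ≤ (A : ℝ) + 0 * u + (B : ℝ) * s := by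
  intro u s hu₁ _ hs₁ hs₂
  have h1 := energyDensityTT'_le_affine_of_polarizedPlaneCheck hM h (hU₁.trans hu₁) hn hs₁ hs₂
  linarith

/-- **Hartree–Fock reading of the certificate ⇒ rectangle plane.** The same certificate read at HALF
density per spin (`n·M² = 2·card`, `n < 2`) gives on `[U₁, U₂] × [s₁, s₂]` (`U₁ ≥ 0`) the plane
`e(t, s, u, n) ≤ 2A + (n/2)²·u + 2B·s`. [cite: BachLiebSolovej1994, eq. (2c.36)] -/
theorem rectPlane_of_hartreeFockPlaneCheck {M : ℕ} (hM : 0 < M) {t s₁ s₂ : ℚ}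
    {sel : ℕ → ℕ → Bool} {card : ℕ} {A B : ℚ}
    (h : polarizedPlaneCheck M t s₁ s₂ sel card A B = true) {n : ℝ}
    (hn : n * (M : ℝ) ^ 2 = 2 * card) (hn2 : n < 2) {U₁ U₂ : ℝ} (hU₁ : 0 ≤ U₁) :
    ∀ u s : ℝ, U₁ ≤ u → u ≤ U₂ → (s₁ : ℝ) ≤ s → s ≤ (s₂ : ℝ) →
      energyDensityTT' (t : ℝ) s u n ≤ 2 * (A : ℝ) + (n / 2) ^ 2 * u + (2 * (B : ℝ)) * s := by
  intro u s hu₁ _ hs₁ hs₂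
  have h1 := energyDensityTT'_le_hartreeFock_of_polarizedPlaneCheck hM h (hU₁.trans hu₁) hn hn2 hs₁ hs₂
  linarith

/-! ### §4 Merging pieces: vertex weakening and `t'`-slivers -/

/-- An affine function of three variables which is `≥ 0` at the eight vertices of a coordinate box
`Set.Icc ![a₀,a₁,a₂] ![b₀,b₁,b₂]` is `≥ 0` on the box. [cite: Rockafellar1970, Thm 32.2] -/
theorem affine₃_nonneg_on_Icc₃ {a₀ a₁ a₂ b₀ b₁ b₂ α β γ δ : ℝ}
    (c₁₁₁ : 0 ≤ α + β * a₀ + γ * a₁ + δ * a₂) (c₁₁₂ : 0 ≤ α + β * a₀ + γ * a₁ + δ * b₂)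
    (c₁₂₁ : 0 ≤ α + β * a₀ + γ * b₁ + δ * a₂) (c₁₂₂ : 0 ≤ α + β * a₀ + γ * b₁ + δ * b₂)
    (c₂₁₁ : 0 ≤ α + β * b₀ + γ * a₁ + δ * a₂) (c₂₁₂ : 0 ≤ α + β * b₀ + γ * a₁ + δ * b₂)
    (c₂₂₁ : 0 ≤ α + β * b₀ + γ * b₁ + δ * a₂) (c₂₂₂ : 0 ≤ α + β * b₀ + γ * b₁ + δ * b₂) :
    ∀ θ ∈ Set.Icc (![a₀, a₁, a₂] : Fin 3 → ℝ) ![b₀, b₁, b₂], 0 ≤ α + β * θ 0 + γ * θ 1 + δ * θ 2 := by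
  intro θ hθ
  obtain ⟨⟨k1, k2⟩, ⟨k3, k4⟩, ⟨k5, k6⟩⟩ := mem_Icc_vec3_iff.1 hθ
  have a₁' : 0 ≤ (α + β * a₀ + γ * a₁) + δ * θ 2 := affine_nonneg_on_Icc k5 k6 c₁₁₁ c₁₁₂
  have a₂' : 0 ≤ (α + β * a₀ + γ * b₁) + δ * θ 2 := affine_nonneg_on_Icc k5 k6 c₁₂₁ c₁₂₂
  have a₃' : 0 ≤ (α + β * b₀ + γ * a₁) + δ * θ 2 := affine_nonneg_on_Icc k5 k6 c₂₁₁ c₂₁₂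
  have a₄' : 0 ≤ (α + β * b₀ + γ * b₁) + δ * θ 2 := affine_nonneg_on_Icc k5 k6 c₂₂₁ c₂₂₂
  have h := affine₂_nonneg_on_rect (α := α + δ * θ 2) (β := β) (γ := γ) k1 k2 k3 k4
    (by linarith) (by linarith) (by linarith) (by linarith)
  linarith

/-- **Weakening an affine floor**: if `L' ≤ e` on a box and the affine `L` is below `L'` at the eight
vertices, then `L ≤ e` on the box. [cite: Rockafellar1970, Thm 32.2] -/
theorem affineFloor_Icc₃_weaken (t : ℝ) {a₀ a₁ a₂ b₀ b₁ b₂ L₀ L₁ L₂ L₃ L₀' L₁' L₂' L₃' : ℝ}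
    (h : ∀ θ ∈ Set.Icc (![a₀, a₁, a₂] : Fin 3 → ℝ) ![b₀, b₁, b₂],
      L₀' + L₁' * θ 0 + L₂' * θ 1 + L₃' * θ 2 ≤ energyDensityTT' t (θ 1) (θ 0) (θ 2))
    (c₁₁₁ : L₀ + L₁ * a₀ + L₂ * a₁ + L₃ * a₂ ≤ L₀' + L₁' * a₀ + L₂' * a₁ + L₃' * a₂)
    (c₁₁₂ : L₀ + L₁ * a₀ + L₂ * a₁ + L₃ * b₂ ≤ L₀' + L₁' * a₀ + L₂' * a₁ + L₃' * b₂)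
    (c₁₂₁ : L₀ + L₁ * a₀ + L₂ * b₁ + L₃ * a₂ ≤ L₀' + L₁' * a₀ + L₂' * b₁ + L₃' * a₂)
    (c₁₂₂ : L₀ + L₁ * a₀ + L₂ * b₁ + L₃ * b₂ ≤ L₀' + L₁' * a₀ + L₂' * b₁ + L₃' * b₂)
    (c₂₁₁ : L₀ + L₁ * b₀ + L₂ * a₁ + L₃ * a₂ ≤ L₀' + L₁' * b₀ + L₂' * a₁ + L₃' * a₂)
    (c₂₁₂ : L₀ + L₁ * b₀ + L₂ * a₁ + L₃ * b₂ ≤ L₀' + L₁' * b₀ + L₂' * a₁ + L₃' * b₂)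
    (c₂₂₁ : L₀ + L₁ * b₀ + L₂ * b₁ + L₃ * a₂ ≤ L₀' + L₁' * b₀ + L₂' * b₁ + L₃' * a₂)
    (c₂₂₂ : L₀ + L₁ * b₀ + L₂ * b₁ + L₃ * b₂ ≤ L₀' + L₁' * b₀ + L₂' * b₁ + L₃' * b₂) :
    ∀ θ ∈ Set.Icc (![a₀, a₁, a₂] : Fin 3 → ℝ) ![b₀, b₁, b₂],
      L₀ + L₁ * θ 0 + L₂ * θ 1 + L₃ * θ 2 ≤ energyDensityTT' t (θ 1) (θ 0) (θ 2) := by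
  intro θ hθ
  have h0 := affine₃_nonneg_on_Icc₃ (α := L₀' - L₀) (β := L₁' - L₁) (γ := L₂' - L₂) (δ := L₃' - L₃)
    (a₀ := a₀) (a₁ := a₁) (a₂ := a₂) (b₀ := b₀) (b₁ := b₁) (b₂ := b₂)
    (by linarith) (by linarith) (by linarith) (by linarith) (by linarith) (by linarith) (by linarith)
    (by linarith) θ hθ
  linarith [h θ hθ]

/-- **Weakening an affine cap**: if `e ≤ H'` on a box and the affine `H` is above `H'` at the eight
vertices, then `e ≤ H` on the box. [cite: Rockafellar1970, Thm 32.2] -/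
theorem affineCap_Icc₃_weaken (t : ℝ) {a₀ a₁ a₂ b₀ b₁ b₂ H₀ H₁ H₂ H₃ H₀' H₁' H₂' H₃' : ℝ}
    (h : ∀ θ ∈ Set.Icc (![a₀, a₁, a₂] : Fin 3 → ℝ) ![b₀, b₁, b₂],
      energyDensityTT' t (θ 1) (θ 0) (θ 2) ≤ H₀' + H₁' * θ 0 + H₂' * θ 1 + H₃' * θ 2)
    (c₁₁₁ : H₀' + H₁' * a₀ + H₂' * a₁ + H₃' * a₂ ≤ H₀ + H₁ * a₀ + H₂ * a₁ + H₃ * a₂)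
    (c₁₁₂ : H₀' + H₁' * a₀ + H₂' * a₁ + H₃' * b₂ ≤ H₀ + H₁ * a₀ + H₂ * a₁ + H₃ * b₂)
    (c₁₂₁ : H₀' + H₁' * a₀ + H₂' * b₁ + H₃' * a₂ ≤ H₀ + H₁ * a₀ + H₂ * b₁ + H₃ * a₂)
    (c₁₂₂ : H₀' + H₁' * a₀ + H₂' * b₁ + H₃' * b₂ ≤ H₀ + H₁ * a₀ + H₂ * b₁ + H₃ * b₂)
    (c₂₁₁ : H₀' + H₁' * b₀ + H₂' * a₁ + H₃' * a₂ ≤ H₀ + H₁ * b₀ + H₂ * a₁ + H₃ * a₂)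
    (c₂₁₂ : H₀' + H₁' * b₀ + H₂' * a₁ + H₃' * b₂ ≤ H₀ + H₁ * b₀ + H₂ * a₁ + H₃ * b₂)
    (c₂₂₁ : H₀' + H₁' * b₀ + H₂' * b₁ + H₃' * a₂ ≤ H₀ + H₁ * b₀ + H₂ * b₁ + H₃ * a₂)
    (c₂₂₂ : H₀' + H₁' * b₀ + H₂' * b₁ + H₃' * b₂ ≤ H₀ + H₁ * b₀ + H₂ * b₁ + H₃ * b₂) :
    ∀ θ ∈ Set.Icc (![a₀, a₁, a₂] : Fin 3 → ℝ) ![b₀, b₁, b₂],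
      energyDensityTT' t (θ 1) (θ 0) (θ 2) ≤ H₀ + H₁ * θ 0 + H₂ * θ 1 + H₃ * θ 2 := by
  intro θ hθ
  have h0 := affine₃_nonneg_on_Icc₃ (α := H₀ - H₀') (β := H₁ - H₁') (γ := H₂ - H₂') (δ := H₃ - H₃')
    (a₀ := a₀) (a₁ := a₁) (a₂ := a₂) (b₀ := b₀) (b₁ := b₁) (b₂ := b₂)
    (by linarith) (by linarith) (by linarith) (by linarith) (by linarith) (by linarith) (by linarith)
    (by linarith) θ hθ
  linarith [h θ hθ]

/-- **Right `t'`-sliver of an affine floor.** An affine floor on `[U₁,U₂] × [s₁,s₂] × [n₁,n₂]`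
(`U₁ ≥ 0`, `s₁ ≤ s₂`, `0 ≤ n₁`, `n₂ < 2`) gives on the sliver `[U₁,U₂] × [s₂,s₃] × [n₁,n₂]` beyond the
last column the affine floor `(L₀ + (L₂ + 1.6212)·s₂) + L₁ U − 1.6212·s + L₃ n` — the face value at
`s₂` carried at the kinematic Lipschitz price `1.6212·(s − s₂)`
(`energyDensityTT'_tPrime_transport_ge_decimal`). [cite: Israel1979, Thm. I.3.4] -/
theorem affineFloor_Icc₃_tPrime_sliver_right (t : ℝ) {U₁ U₂ s₁ s₂ s₃ n₁ n₂ L₀ L₁ L₂ L₃ : ℝ}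
    (hU₁ : 0 ≤ U₁) (hs : s₁ ≤ s₂) (hn0 : 0 ≤ n₁) (hn2 : n₂ < 2)
    (h : ∀ θ ∈ Set.Icc (![U₁, s₁, n₁] : Fin 3 → ℝ) ![U₂, s₂, n₂],
      L₀ + L₁ * θ 0 + L₂ * θ 1 + L₃ * θ 2 ≤ energyDensityTT' t (θ 1) (θ 0) (θ 2)) :
    ∀ θ ∈ Set.Icc (![U₁, s₂, n₁] : Fin 3 → ℝ) ![U₂, s₃, n₂],
      (L₀ + (L₂ + 1.6212) * s₂) + L₁ * θ 0 + (-1.6212) * θ 1 + L₃ * θ 2 ≤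
        energyDensityTT' t (θ 1) (θ 0) (θ 2) := by
  intro θ hθ
  obtain ⟨⟨k1, k2⟩, ⟨k3, _⟩, ⟨k5, k6⟩⟩ := mem_Icc_vec3_iff.1 hθ
  have h₁ := h ![θ 0, s₂, θ 2] (mem_Icc_vec3_iff.2 ⟨⟨k1, k2⟩, ⟨hs, le_rfl⟩, ⟨k5, k6⟩⟩)
  simp only [Matrix.cons_val_zero, Matrix.cons_val_one, Matrix.cons_val] at h₁
  have hlip := energyDensityTT'_tPrime_transport_ge_decimal t (U := θ 0) (hU₁.trans k1)
    (hn0.trans k5) (lt_of_le_of_lt k6 hn2) s₂ (θ 1)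
  rw [abs_of_nonneg (sub_nonneg.2 k3)] at hlip
  linarith

/-- **Left `t'`-sliver of an affine floor**: on `[U₁,U₂] × [s₀,s₁] × [n₁,n₂]` the affine floor
`(L₀ + (L₂ − 1.6212)·s₁) + L₁ U + 1.6212·s + L₃ n`. [cite: Israel1979, Thm. I.3.4] -/
theorem affineFloor_Icc₃_tPrime_sliver_left (t : ℝ) {U₁ U₂ s₀ s₁ s₂ n₁ n₂ L₀ L₁ L₂ L₃ : ℝ}
    (hU₁ : 0 ≤ U₁) (hs : s₁ ≤ s₂) (hn0 : 0 ≤ n₁) (hn2 : n₂ < 2)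
    (h : ∀ θ ∈ Set.Icc (![U₁, s₁, n₁] : Fin 3 → ℝ) ![U₂, s₂, n₂],
      L₀ + L₁ * θ 0 + L₂ * θ 1 + L₃ * θ 2 ≤ energyDensityTT' t (θ 1) (θ 0) (θ 2)) :
    ∀ θ ∈ Set.Icc (![U₁, s₀, n₁] : Fin 3 → ℝ) ![U₂, s₁, n₂],
      (L₀ + (L₂ - 1.6212) * s₁) + L₁ * θ 0 + (1.6212 : ℝ) * θ 1 + L₃ * θ 2 ≤
        energyDensityTT' t (θ 1) (θ 0) (θ 2) := by
  intro θ hθ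
  obtain ⟨⟨k1, k2⟩, ⟨_, k4⟩, ⟨k5, k6⟩⟩ := mem_Icc_vec3_iff.1 hθ
  have h₁ := h ![θ 0, s₁, θ 2] (mem_Icc_vec3_iff.2 ⟨⟨k1, k2⟩, ⟨le_rfl, hs⟩, ⟨k5, k6⟩⟩)
  simp only [Matrix.cons_val_zero, Matrix.cons_val_one, Matrix.cons_val] at h₁
  have hlip := energyDensityTT'_tPrime_transport_ge_decimal t (U := θ 0) (hU₁.trans k1)
    (hn0.trans k5) (lt_of_le_of_lt k6 hn2) s₁ (θ 1)
  rw [abs_of_nonpos (sub_nonpos.2 k4)] at hlip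
  linarith

/-- **Right `t'`-sliver of an affine cap**: on `[U₁,U₂] × [s₂,s₃] × [n₁,n₂]` the affine cap
`(H₀ + (H₂ − 1.6212)·s₂) + H₁ U + 1.6212·s + H₃ n`. [cite: Israel1979, Thm. I.3.4] -/
theorem affineCap_Icc₃_tPrime_sliver_right (t : ℝ) {U₁ U₂ s₁ s₂ s₃ n₁ n₂ H₀ H₁ H₂ H₃ : ℝ}
    (hU₁ : 0 ≤ U₁) (hs : s₁ ≤ s₂) (hn0 : 0 ≤ n₁) (hn2 : n₂ < 2)
    (h : ∀ θ ∈ Set.Icc (![U₁, s₁, n₁] : Fin 3 → ℝ) ![U₂, s₂, n₂],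
      energyDensityTT' t (θ 1) (θ 0) (θ 2) ≤ H₀ + H₁ * θ 0 + H₂ * θ 1 + H₃ * θ 2) :
    ∀ θ ∈ Set.Icc (![U₁, s₂, n₁] : Fin 3 → ℝ) ![U₂, s₃, n₂],
      energyDensityTT' t (θ 1) (θ 0) (θ 2) ≤
        (H₀ + (H₂ - 1.6212) * s₂) + H₁ * θ 0 + (1.6212 : ℝ) * θ 1 + H₃ * θ 2 := by
  intro θ hθ
  obtain ⟨⟨k1, k2⟩, ⟨k3, _⟩, ⟨k5, k6⟩⟩ := mem_Icc_vec3_iff.1 hθ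
  have h₁ := h ![θ 0, s₂, θ 2] (mem_Icc_vec3_iff.2 ⟨⟨k1, k2⟩, ⟨hs, le_rfl⟩, ⟨k5, k6⟩⟩)
  simp only [Matrix.cons_val_zero, Matrix.cons_val_one, Matrix.cons_val] at h₁
  have hlip := energyDensityTT'_tPrime_transport_ge_decimal t (U := θ 0) (hU₁.trans k1)
    (hn0.trans k5) (lt_of_le_of_lt k6 hn2) (θ 1) s₂
  rw [abs_of_nonpos (sub_nonpos.2 k3)] at hlip
  linarith

/-- **Left `t'`-sliver of an affine cap**: on `[U₁,U₂] × [s₀,s₁] × [n₁,n₂]` the affine cap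
`(H₀ + (H₂ + 1.6212)·s₁) + H₁ U − 1.6212·s + H₃ n`. [cite: Israel1979, Thm. I.3.4] -/
theorem affineCap_Icc₃_tPrime_sliver_left (t : ℝ) {U₁ U₂ s₀ s₁ s₂ n₁ n₂ H₀ H₁ H₂ H₃ : ℝ}
    (hU₁ : 0 ≤ U₁) (hs : s₁ ≤ s₂) (hn0 : 0 ≤ n₁) (hn2 : n₂ < 2)
    (h : ∀ θ ∈ Set.Icc (![U₁, s₁, n₁] : Fin 3 → ℝ) ![U₂, s₂, n₂],
      energyDensityTT' t (θ 1) (θ 0) (θ 2) ≤ H₀ + H₁ * θ 0 + H₂ * θ 1 + H₃ * θ 2) :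
    ∀ θ ∈ Set.Icc (![U₁, s₀, n₁] : Fin 3 → ℝ) ![U₂, s₁, n₂],
      energyDensityTT' t (θ 1) (θ 0) (θ 2) ≤
        (H₀ + (H₂ + 1.6212) * s₁) + H₁ * θ 0 + (-1.6212) * θ 1 + H₃ * θ 2 := by
  intro θ hθ
  obtain ⟨⟨k1, k2⟩, ⟨_, k4⟩, ⟨k5, k6⟩⟩ := mem_Icc_vec3_iff.1 hθ
  have h₁ := h ![θ 0, s₁, θ 2] (mem_Icc_vec3_iff.2 ⟨⟨k1, k2⟩, ⟨le_rfl, hs⟩, ⟨k5, k6⟩⟩)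
  simp only [Matrix.cons_val_zero, Matrix.cons_val_one, Matrix.cons_val] at h₁
  have hlip := energyDensityTT'_tPrime_transport_ge_decimal t (U := θ 0) (hU₁.trans k1)
    (hn0.trans k5) (lt_of_le_of_lt k6 hn2) (θ 1) s₁
  rw [abs_of_nonneg (sub_nonneg.2 k4)] at hlip
  linarith

end ThermodynamicLimit

end Literature.MathematicalPhysics.QuantumLattice
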